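import Literature.Probability.RandomMatrixProducts.AndersonModel1DLargeDeviations
import Literature.Probability.RandomMatrixProducts.AndersonModel1DCircle
import Mathlib.Probability.Moments.SubGaussian
import HarnessLib

/-!
# Concentration of `log ‖M_n^E v‖` for the Anderson transfer matrices: the uniform large-deviation theorems from uniform convergence of the block means

Companion to `AndersonModel1D.lean` / `AndersonModel1DLargeDeviations.lean` (transfer matrices
`M^E(α) = [[E - α, -1],[1, 0]]` of the one-dimensional Anderson model; Bucaj–Damanik–Fillman–
Gerbuz–VandenBoom–Wang–Zhang, TAMS **372** (2019), arXiv:1706.06135, §3).  Everything here is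
PROVED; the file introduces no named facts.  (Generic continuity lemmas are taken from
`AndersonModel1DCircle.lean`.)

## Main result

`BucajEtAl2019_vectorLDT_of_blockMeans`: the vectorwise uniform large-deviation theorem
(Prop. 3.6 of the source, the named fact `BucajEtAl2019_vectorLDT`) — and with it the matrix-norm
LDT (Thm 3.1, `BucajEtAl2019_matrixLDT`, via `BucajEtAl2019_matrixLDT_of_vectorLDT`) — follows
from the following uniform convergence statement for the BLOCK MEANS
`g_N^E(u) = ∫ log ‖M_N^E(y) u‖ dμ^{⊗N}(y)` (`andersonBlockMean`):

  (HU) for every `ε > 0` there is `N ≥ 1` with `|N⁻¹ g_N^E(u) - L(E)| ≤ ε` for every unit vector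
  `u` and every `E ∈ Σ̂ = [-κ, κ]`.

(HU) is exactly as strong as Prop. 3.6: `andersonBlockMeans_of_vectorLDT` proves the converse
implication.  It is the form in which the Furstenberg–Kifer / Bougerol–Lacroix theory (uniqueness
of the `ν_E`-stationary measure under strong irreducibility and contraction of `G_{ν_E}`,
Thm 2.3 / Prop. 2.9 / Prop. 2.10 of the source, plus compactness of `Σ̂`) delivers its output, and
it is what remains to be proved to discharge the two named facts.

## The argument (block martingale and Hoeffding's lemma)

Fix `E ∈ Σ̂`, a block length `N` and a unit vector `v`; write `u_p(β)` for the direction of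
`M_{Np}(β) v` (`andersonDir`), `X_p(β) = log ‖M_N(β(Np + ·)) u_p(β)‖` (`andersonBlockLog`) and
`S_P(β) = Σ_{p<P} (X_p(β) - g_N(u_p(β)))` (`andersonBlockSum`).
* Telescoping (`log_norm_transferProd_blocks`): `log ‖M_{NP}(β) v‖ = Σ_{p<P} X_p(β)`.
* On the support box (`|β_j| ≤ κ - 2` a.s.) every block term and every block mean lies in
  `[-N log(2κ-1), N log(2κ-1)]` (`abs_log_norm_apply_le`; `Γ ≤ 2κ - 1`).
* `S_P` is a martingale with bounded increments: peeling off the last block by Tonelli over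
  `μ^{⊗(NP+N)} = μ^{⊗NP} ⊗ μ^{⊗N}` (`lintegral_pi_fin_add`) and applying Hoeffding's lemma
  (`ProbabilityTheory.hasSubgaussianMGF_of_mem_Icc`) to the last block with the entrance direction
  frozen gives `∫ exp(t S_P) dμ^{⊗NP} ≤ exp(P (N log(2κ-1))² t²/2)` (`lintegral_exp_blockSum_le`),
  i.e. `S_P` is sub-Gaussian (`hasSubgaussianMGF_blockSum`) with two-sided Chernoff tails
  (`measure_abs_blockSum_ge_le`).
* Under (HU) at precision `ε/2`, for `n = NP + r` (`r < N`) a deviation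
  `|n⁻¹ log ‖M_n v‖ - L(E)| ≥ ε` forces `|S_P| ≥ NPε/4` as soon as `Pε ≥ 8 log(2κ-1)`
  (`measure_andersonVectorLDSet_le_of_blockMeans`), whence
  `μ^{⊗n}(deviation) ≤ 2 exp(-P ε²/(32 log²(2κ-1))) ≤ C e^{-ηn}`, `η = ε²/(32 N log²(2κ-1))`,
  uniformly in `v` and `E ∈ Σ̂` (`andersonVectorLDT_of_blockMeans`); small `n` are absorbed into `C`.

This replaces the Chebyshev count (Lemma 3.5) and the `δ^m` independence estimate of the printed
proof of Prop. 3.6, whose input (Prop. 3.4: smallness IN PROBABILITY of the block deviations,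
locally uniformly in `E`) is stronger than (HU); the exponential rate obtained is explicit.
The method (blocking + Azuma/Hoeffding for the martingale of block log-growths) is standard in the
theory of random matrix products. [folklore]

## Reductions of the hypothesis

* `integral_eq_zero_of_hasSubgaussianMGF`: a sub-Gaussian variable (MGF sense, all real `t`) is
  centred; hence `𝔼 S_P = 0` and `g_{NP}(v) = Σ_p 𝔼 g_N(u_p)`, so (HU) at block length `N`
  propagates to every multiple `NP` (`andersonBlockMean_mul_le`).
* `andersonBlockMeans_uniform_of_local`: by compactness of `Σ̂` (and the previous point with the
  product of finitely many block lengths) it suffices to have (HU) LOCALLY: for every `E₀ ∈ Σ̂` and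
  `ε > 0` a radius `ρ` and a block length `N` working for all `E ∈ Σ̂ ∩ (E₀ - ρ, E₀ + ρ)` —
  the form produced by a contradiction / weak-* compactness argument at a single energy
  (`BucajEtAl2019_vectorLDT_of_localBlockMeans`, `BucajEtAl2019_matrixLDT_of_localBlockMeans`).
-/

noncomputable section

open MeasureTheory ProbabilityTheory Filter
open scoped Matrix.Norms.L2Operator Matrix ENNReal NNReal

namespace Literature.Probability.RandomMatrixProducts

/-! ### Invertible matrices do not kill vectors (cf. `toEuclideanLin_apply_ne_zero`) -/

/-- `‖M w‖ > 0` for `det M = 1` and `w ≠ 0`. [folklore] -/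
theorem norm_toEuclideanLin_pos_of_det_eq_one (M : Matrix (Fin 2) (Fin 2) ℝ) (hM : M.det = 1)
    {w : EuclideanSpace ℝ (Fin 2)} (hw : w ≠ 0) : 0 < ‖Matrix.toEuclideanLin M w‖ :=
  norm_pos_iff.mpr (toEuclideanLin_apply_ne_zero (by rw [hM]; exact one_ne_zero) hw)

/-! ### Continuity in the sample -/

/-- Products of transfer matrices over a continuously parametrised sample are continuous.
[folklore] -/
theorem continuous_andersonTransferProd_family {X : Type*} [TopologicalSpace X] (E : ℝ)
    (β : X → ℕ → ℝ) (hβ : ∀ j, Continuous fun x => β x j) :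
    ∀ k, Continuous fun x => andersonTransferProd E (β x) k
  | 0 => by simpa using continuous_const
  | k + 1 => by
    simp only [andersonTransferProd_succ]
    refine Continuous.mul ?_ (continuous_andersonTransferProd_family E β hβ k)
    have hc := hβ k
    refine continuous_matrix fun i j => ?_
    fin_cases i <;> fin_cases j <;> simp [andersonTransfer] <;> fun_prop

/-- `α ↦ padSeq α j` is continuous. [folklore] -/
theorem continuous_padSeq_apply (n j : ℕ) : Continuous fun α : Fin n → ℝ => padSeq α j := by
  unfold padSeq
  split_ifs with h
  · exact continuous_apply _
  · exact continuous_const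

/-! ### Directions, block log-growths and the telescoping identity -/

/-- The direction `M_k(β) v / ‖M_k(β) v‖` of `v` after `k` steps. [folklore] -/
def andersonDir (E : ℝ) (β : ℕ → ℝ) (k : ℕ) (v : EuclideanSpace ℝ (Fin 2)) :
    EuclideanSpace ℝ (Fin 2) :=
  (‖Matrix.toEuclideanLin (andersonTransferProd E β k) v‖⁻¹ : ℝ) •
    Matrix.toEuclideanLin (andersonTransferProd E β k) v

/-- The direction is a unit vector (`v ≠ 0`). [folklore] -/
theorem norm_andersonDir (E : ℝ) (β : ℕ → ℝ) (k : ℕ) {v : EuclideanSpace ℝ (Fin 2)} (hv : v ≠ 0) :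
    ‖andersonDir E β k v‖ = 1 := by
  unfold andersonDir
  have hpos := norm_toEuclideanLin_pos_of_det_eq_one _ (det_andersonTransferProd E β k) hv
  rw [norm_smul, norm_inv, norm_norm, inv_mul_cancel₀ hpos.ne']

/-- The direction is non-zero (`v ≠ 0`). [folklore] -/
theorem andersonDir_ne_zero (E : ℝ) (β : ℕ → ℝ) (k : ℕ) {v : EuclideanSpace ℝ (Fin 2)} (hv : v ≠ 0) :
    andersonDir E β k v ≠ 0 := by
  rw [← norm_ne_zero_iff, norm_andersonDir E β k hv]; exact one_ne_zero

/-- The direction after `k` steps depends on `β_0, …, β_{k-1}` only. [folklore] -/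
theorem andersonDir_congr (E : ℝ) {β β' : ℕ → ℝ} (k : ℕ) (v : EuclideanSpace ℝ (Fin 2))
    (h : ∀ j, j < k → β j = β' j) : andersonDir E β k v = andersonDir E β' k v := by
  unfold andersonDir; rw [andersonTransferProd_congr E k h]

/-- **The block log-growth** `X_p(β) = log ‖M_N(β(Np + ·)) u_p(β)‖`, `u_p` the direction of
`M_{Np}(β) v`: the growth of `v` over the `p`-th block of length `N`.
[cite: BucajEtAl2019, §3 (proof of Prop. 3.6, the vectors `v_p`)] -/
def andersonBlockLog (E : ℝ) (N : ℕ) (v : EuclideanSpace ℝ (Fin 2)) (β : ℕ → ℝ) (p : ℕ) : ℝ :=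
  Real.log ‖Matrix.toEuclideanLin (andersonTransferProd E (fun j => β (N * p + j)) N)
    (andersonDir E β (N * p) v)‖

/-- `X_p(β)` depends on `β_0, …, β_{N(p+1)-1}` only. [folklore] -/
theorem andersonBlockLog_congr (E : ℝ) (N : ℕ) (v : EuclideanSpace ℝ (Fin 2)) {β β' : ℕ → ℝ}
    (p : ℕ) (h : ∀ j, j < N * p + N → β j = β' j) :
    andersonBlockLog E N v β p = andersonBlockLog E N v β' p := by
  unfold andersonBlockLog
  rw [andersonDir_congr E (N * p) v fun j hj => h j (by omega),
    andersonTransferProd_congr E N (α := fun j => β (N * p + j)) (β := fun j => β' (N * p + j))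
      fun j hj => h _ (by omega)]

/-- **One peeling step**: `log ‖M_{m+k}(β) v‖ = log ‖M_m(β) v‖ + log ‖M_k(β(m + ·)) u_m‖` with
`u_m` the direction of `M_m(β) v` (`v ≠ 0`).
[cite: BucajEtAl2019, §3 (proof of Prop. 3.6, the telescoping display)] -/
theorem log_norm_transferProd_add_apply (E : ℝ) (β : ℕ → ℝ) (m k : ℕ)
    {v : EuclideanSpace ℝ (Fin 2)} (hv : v ≠ 0) :
    Real.log ‖Matrix.toEuclideanLin (andersonTransferProd E β (m + k)) v‖ =
      Real.log ‖Matrix.toEuclideanLin (andersonTransferProd E β m) v‖ +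
        Real.log ‖Matrix.toEuclideanLin (andersonTransferProd E (fun j => β (m + j)) k)
          (andersonDir E β m v)‖ := by
  rw [andersonTransferProd_add, toEuclideanLin_mul_apply]
  set w := Matrix.toEuclideanLin (andersonTransferProd E β m) v with hw_def
  set A := andersonTransferProd E (fun j => β (m + j)) k with hA_def
  have hw : 0 < ‖w‖ := norm_toEuclideanLin_pos_of_det_eq_one _ (det_andersonTransferProd E β m) hv
  have hdir : andersonDir E β m v = (‖w‖⁻¹ : ℝ) • w := rfl
  have h1 : Matrix.toEuclideanLin A w = (‖w‖ : ℝ) • Matrix.toEuclideanLin A (andersonDir E β m v) := by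
    rw [hdir, map_smul, smul_smul, mul_inv_cancel₀ hw.ne', one_smul]
  have hApos : 0 < ‖Matrix.toEuclideanLin A (andersonDir E β m v)‖ :=
    norm_toEuclideanLin_pos_of_det_eq_one _ (det_andersonTransferProd E _ k)
      (andersonDir_ne_zero E β m hv)
  rw [h1, norm_smul, norm_norm, Real.log_mul hw.ne' hApos.ne']

/-- `M_0 v = v`. [folklore] -/
theorem toEuclideanLin_transferProd_zero (E : ℝ) (β : ℕ → ℝ) (v : EuclideanSpace ℝ (Fin 2)) :
    Matrix.toEuclideanLin (andersonTransferProd E β 0) v = v := by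
  rw [andersonTransferProd_zero]
  show WithLp.toLp 2 ((1 : Matrix (Fin 2) (Fin 2) ℝ) *ᵥ v.ofLp) = v
  simp

/-- **Telescoping over blocks**: `log ‖M_{NP}(β) v‖ = Σ_{p<P} X_p(β)` for a unit vector `v`.
[cite: BucajEtAl2019, §3 (proof of Prop. 3.6, the telescoping display)] -/
theorem log_norm_transferProd_blocks (E : ℝ) (N : ℕ) (β : ℕ → ℝ) {v : EuclideanSpace ℝ (Fin 2)}
    (hv : ‖v‖ = 1) :
    ∀ P, Real.log ‖Matrix.toEuclideanLin (andersonTransferProd E β (N * P)) v‖ =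
      ∑ p ∈ Finset.range P, andersonBlockLog E N v β p
  | 0 => by simp [hv]
  | P + 1 => by
    have hv0 : v ≠ 0 := by rw [← norm_ne_zero_iff, hv]; exact one_ne_zero
    rw [Nat.mul_succ, log_norm_transferProd_add_apply E β (N * P) N hv0,
      log_norm_transferProd_blocks E N β hv P, Finset.sum_range_succ]
    rfl

/-! ### Block means and the centred block sum -/

/-- **The block mean** `g(u) = ∫ log ‖M_N(y) u‖ dμ^{⊗N}(y)`: the conditional expectation of a block
log-growth given the entrance direction `u`. [cite: BucajEtAl2019, §3 (proof of Prop. 3.6)] -/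
def andersonBlockMean (μ : Measure ℝ) (E : ℝ) (N : ℕ) (u : EuclideanSpace ℝ (Fin 2)) : ℝ :=
  ∫ y, Real.log ‖Matrix.toEuclideanLin (andersonTransferProd E (padSeq y) N) u‖
    ∂(Measure.pi fun _ : Fin N => μ)

/-- **The centred block sum** `S_P(β) = Σ_{p<P} (X_p(β) - g(u_p(β)))` — a martingale in `P` with
bounded increments under `μ^{⊗ℕ}`. [folklore] -/
def andersonBlockSum (μ : Measure ℝ) (E : ℝ) (N : ℕ) (v : EuclideanSpace ℝ (Fin 2)) (β : ℕ → ℝ)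
    (P : ℕ) : ℝ :=
  ∑ p ∈ Finset.range P,
    (andersonBlockLog E N v β p - andersonBlockMean μ E N (andersonDir E β (N * p) v))

/-- `S_P(β)` depends on `β_0, …, β_{NP-1}` only. [folklore] -/
theorem andersonBlockSum_congr (μ : Measure ℝ) (E : ℝ) (N : ℕ) (v : EuclideanSpace ℝ (Fin 2))
    {β β' : ℕ → ℝ} (P : ℕ) (h : ∀ j, j < N * P → β j = β' j) :
    andersonBlockSum μ E N v β P = andersonBlockSum μ E N v β' P := by
  unfold andersonBlockSum
  refine Finset.sum_congr rfl fun p hp => ?_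
  have hp' : p + 1 ≤ P := Finset.mem_range.mp hp
  have hle : N * p + N ≤ N * P := by
    calc N * p + N = N * (p + 1) := by ring
      _ ≤ N * P := Nat.mul_le_mul_left N hp'
  rw [andersonBlockLog_congr E N v p fun j hj => h j (lt_of_lt_of_le hj hle),
    andersonDir_congr E (N * p) v fun j hj => h j (by omega)]

/-- Appending a block: `S_{P+1}(x ⧺ y) = S_P(x) + (log ‖M_N(y) u‖ - g(u))`, `u` the direction of
`M_{NP}(x) v`. [cite: BucajEtAl2019, §3 (proof of Prop. 3.6, the independence step)] -/
theorem andersonBlockSum_succ_append (μ : Measure ℝ) (E : ℝ) (N : ℕ) (v : EuclideanSpace ℝ (Fin 2))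
    (P : ℕ) (x : Fin (N * P) → ℝ) (y : Fin N → ℝ) :
    andersonBlockSum μ E N v (padSeq (Fin.append x y)) (P + 1) =
      andersonBlockSum μ E N v (padSeq x) P +
        (Real.log ‖Matrix.toEuclideanLin (andersonTransferProd E (padSeq y) N)
            (andersonDir E (padSeq x) (N * P) v)‖ -
          andersonBlockMean μ E N (andersonDir E (padSeq x) (N * P) v)) := by
  have hS : andersonBlockSum μ E N v (padSeq (Fin.append x y)) P =
      andersonBlockSum μ E N v (padSeq x) P :=
    andersonBlockSum_congr μ E N v P fun j hj => padSeq_append_of_lt x y hj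
  have hdir : andersonDir E (padSeq (Fin.append x y)) (N * P) v = andersonDir E (padSeq x) (N * P) v :=
    andersonDir_congr E (N * P) v fun j hj => padSeq_append_of_lt x y hj
  have hM : andersonTransferProd E (fun j => padSeq (Fin.append x y) (N * P + j)) N =
      andersonTransferProd E (padSeq y) N :=
    andersonTransferProd_congr E N fun j hj => padSeq_append_add x y hj
  unfold andersonBlockSum
  rw [Finset.sum_range_succ]
  unfold andersonBlockSum at hS
  rw [hS]
  unfold andersonBlockLog
  rw [hdir, hM]

/-! ### Continuity and measurability of the block quantities in the sample -/

/-- `α ↦ u_k(padSeq α)` is continuous (`v ≠ 0`). [folklore] -/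
theorem continuous_andersonDir_padSeq (E : ℝ) {n : ℕ} (k : ℕ) {v : EuclideanSpace ℝ (Fin 2)}
    (hv : v ≠ 0) : Continuous fun α : Fin n → ℝ => andersonDir E (padSeq α) k v := by
  unfold andersonDir
  have hw := continuous_andersonTransferProd_apply E (n := n) k v
  refine Continuous.smul (Continuous.inv₀ hw.norm fun α => ?_) hw
  exact (norm_toEuclideanLin_pos_of_det_eq_one _ (det_andersonTransferProd E _ k) hv).ne'

/-- Entries of a shifted block product are continuous in the sample. [folklore] -/
theorem continuous_andersonTransferProd_shift_entry (E : ℝ) {n : ℕ} (s k : ℕ) (i j : Fin 2) :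
    Continuous fun α : Fin n → ℝ => andersonTransferProd E (fun l => padSeq α (s + l)) k i j :=
  (continuous_apply j).comp ((continuous_apply i).comp
    (continuous_andersonTransferProd_family E (fun (α : Fin n → ℝ) l => padSeq α (s + l))
      (fun l => continuous_padSeq_apply n (s + l)) k))

/-- `α ↦ M_k(padSeq α (s + ·)) u(α)` is continuous for a continuous direction field `u`. [folklore] -/
theorem continuous_shift_apply (E : ℝ) {n : ℕ} (s k : ℕ) {u : (Fin n → ℝ) → EuclideanSpace ℝ (Fin 2)}
    (hu : Continuous u) :
    Continuous fun α : Fin n → ℝ =>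
      Matrix.toEuclideanLin (andersonTransferProd E (fun l => padSeq α (s + l)) k) (u α) :=
  continuous_toEuclideanLin_apply (fun i j => continuous_andersonTransferProd_shift_entry E s k i j) hu

/-- `α ↦ X_p(padSeq α)` is continuous (`v ≠ 0`). [folklore] -/
theorem continuous_andersonBlockLog_padSeq (E : ℝ) (N : ℕ) {n : ℕ} (p : ℕ)
    {v : EuclideanSpace ℝ (Fin 2)} (hv : v ≠ 0) : Continuous fun α : Fin n → ℝ => andersonBlockLog E N v (padSeq α) p := by
  unfold andersonBlockLog
  refine Continuous.log
    (continuous_shift_apply E (N * p) N (continuous_andersonDir_padSeq E (N * p) hv)).norm fun α => ?_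
  exact (norm_toEuclideanLin_pos_of_det_eq_one _ (det_andersonTransferProd E _ N)
    (andersonDir_ne_zero E _ _ hv)).ne'

/-- Joint continuity of `(α, y) ↦ log ‖M_N(padSeq y) u(α)‖` for a continuous non-vanishing direction
field `u`. [folklore] -/
theorem continuous_log_norm_block_prod {n N : ℕ} (E : ℝ) {u : (Fin n → ℝ) → EuclideanSpace ℝ (Fin 2)}
    (hu : Continuous u) (hu0 : ∀ α, u α ≠ 0) :
    Continuous fun z : (Fin n → ℝ) × (Fin N → ℝ) =>
      Real.log ‖Matrix.toEuclideanLin (andersonTransferProd E (padSeq z.2) N) (u z.1)‖ := by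
  have hA : ∀ i j, Continuous fun z : (Fin n → ℝ) × (Fin N → ℝ) =>
      andersonTransferProd E (padSeq z.2) N i j := fun i j =>
    (continuous_apply j).comp ((continuous_apply i).comp
      ((continuous_andersonTransferProd E (n := N) N).comp continuous_snd))
  have happ := continuous_toEuclideanLin_apply hA (hu.comp continuous_fst)
  refine Continuous.log happ.norm fun z => ?_
  exact (norm_toEuclideanLin_pos_of_det_eq_one _ (det_andersonTransferProd E _ N) (hu0 z.1)).ne'

/-- `α ↦ g(u(α))` is measurable for a continuous non-vanishing direction field `u`. [folklore] -/
theorem measurable_andersonBlockMean_comp (μ : Measure ℝ) [SigmaFinite μ] {n : ℕ} (E : ℝ) (N : ℕ)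
    {u : (Fin n → ℝ) → EuclideanSpace ℝ (Fin 2)} (hu : Continuous u) (hu0 : ∀ α, u α ≠ 0) :
    Measurable fun α : Fin n → ℝ => andersonBlockMean μ E N (u α) := by
  unfold andersonBlockMean
  have h := (continuous_log_norm_block_prod (N := N) E hu hu0).measurable.stronglyMeasurable
  exact (h.integral_prod_right' (ν := Measure.pi fun _ : Fin N => μ)).measurable

/-- `α ↦ S_P(padSeq α)` is measurable (`v ≠ 0`). [folklore] -/
theorem measurable_andersonBlockSum_padSeq (μ : Measure ℝ) [SigmaFinite μ] (E : ℝ) (N : ℕ) {n : ℕ}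
    {v : EuclideanSpace ℝ (Fin 2)} (hv : v ≠ 0) (P : ℕ) :
    Measurable fun α : Fin n → ℝ => andersonBlockSum μ E N v (padSeq α) P := by
  unfold andersonBlockSum
  refine Finset.measurable_sum _ fun p _ => ?_
  exact (continuous_andersonBlockLog_padSeq E N p hv).measurable.sub
    (measurable_andersonBlockMean_comp μ E N (continuous_andersonDir_padSeq E (N * p) hv)
      fun α => andersonDir_ne_zero E _ _ hv)

/-! ### Bounds on the block quantities over the support box -/

/-- On `Σ̂ × (support box)` every padded potential satisfies `|E - padSeq x k| ≤ 2κ - 2`, also beyond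
the sample (where the padding is `0` and `|E| ≤ κ ≤ 2κ - 2`). [folklore] -/
theorem abs_energy_sub_padSeq_le_all {μ : Measure ℝ} {E : ℝ}
    (hE : E ∈ Set.Icc (-andersonKappa μ) (andersonKappa μ)) {n : ℕ} {x : Fin n → ℝ}
    (hx : ∀ i, |x i| ≤ andersonKappa μ - 2) (k : ℕ) : |E - padSeq x k| ≤ 2 * andersonKappa μ - 2 := by
  by_cases hk : k < n
  · exact abs_energy_sub_padSeq_le hE hx k hk
  · rw [padSeq_of_le x (not_lt.mp hk), sub_zero]
    have := two_le_andersonKappa μ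
    exact (abs_le.mpr ⟨by linarith [hE.1], hE.2⟩).trans (by linarith)

/-- **Two-sided block bound**: `|log ‖M_k(β) u‖| ≤ k log (D+1)` for a unit vector `u` when
`|E - β_j| ≤ D` (`j < k`). [cite: BucajEtAl2019, §3 (display (3.3), `|F_n| ≤ log Γ`)] -/
theorem abs_log_norm_apply_le (E : ℝ) {D : ℝ} (hD : 0 ≤ D) (β : ℕ → ℝ) (k : ℕ)
    (hβ : ∀ j, j < k → |E - β j| ≤ D) {u : EuclideanSpace ℝ (Fin 2)} (hu : ‖u‖ = 1) :
    |Real.log ‖Matrix.toEuclideanLin (andersonTransferProd E β k) u‖| ≤ k * Real.log (D + 1) := by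
  obtain ⟨h1, h2⟩ := norm_andersonTransferProd_apply_bounds E hD β u k hβ
  rw [hu, mul_one] at h1
  rw [hu] at h2
  have hpow : (0 : ℝ) < (D + 1) ^ k := by positivity
  have hpos : 0 < ‖Matrix.toEuclideanLin (andersonTransferProd E β k) u‖ := by
    by_contra hle
    have h0 : ‖Matrix.toEuclideanLin (andersonTransferProd E β k) u‖ = 0 :=
      le_antisymm (not_lt.mp hle) (norm_nonneg _)
    rw [h0, mul_zero] at h2
    exact absurd h2 (by norm_num)
  rw [abs_le]
  constructor
  · have := Real.log_le_log one_pos h2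
    rw [Real.log_one, Real.log_mul hpow.ne' hpos.ne', Real.log_pow] at this
    linarith
  · calc Real.log ‖Matrix.toEuclideanLin (andersonTransferProd E β k) u‖ ≤ Real.log ((D + 1) ^ k) :=
          Real.log_le_log hpos h1
      _ = k * Real.log (D + 1) := Real.log_pow _ _

/-- `log (2κ - 1) > 0` (`κ ≥ 2`). [folklore] -/
theorem log_two_mul_andersonKappa_sub_one_pos (μ : Measure ℝ) :
    0 < Real.log (2 * andersonKappa μ - 1) :=
  Real.log_pos (by linarith [two_le_andersonKappa μ])

/-! ### Hoeffding's lemma for one block and the moment-generating function of `S_P` -/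

/-- **One block is conditionally sub-Gaussian** (Hoeffding's lemma): for `E ∈ Σ̂`, a unit vector `u`
and every `t`, `∫ exp(t (log ‖M_N(y) u‖ - g(u))) dμ^{⊗N}(y) ≤ exp((N log(2κ-1))² t²/2)`, because
`log ‖M_N(y) u‖ ∈ [-N log(2κ-1), N log(2κ-1)]` for a.e. sample `y`. [folklore] -/
theorem lintegral_exp_centered_blockLog_le (μ : Measure ℝ) [IsProbabilityMeasure μ]
    (hcpt : IsCompact μ.support) {E : ℝ} (hE : E ∈ Set.Icc (-andersonKappa μ) (andersonKappa μ))
    (N : ℕ) {u : EuclideanSpace ℝ (Fin 2)} (hu : ‖u‖ = 1) (t : ℝ) :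
    ∫⁻ y, ENNReal.ofReal (Real.exp (t *
        (Real.log ‖Matrix.toEuclideanLin (andersonTransferProd E (padSeq y) N) u‖ -
          andersonBlockMean μ E N u))) ∂(Measure.pi fun _ : Fin N => μ) ≤
      ENNReal.ofReal (Real.exp (((N : ℝ) * Real.log (2 * andersonKappa μ - 1)) ^ 2 * t ^ 2 / 2)) := by
  set G := Real.log (2 * andersonKappa μ - 1) with hG_def
  set P := Measure.pi fun _ : Fin N => μ with hP_def
  have hu0 : u ≠ 0 := by rw [← norm_ne_zero_iff, hu]; exact one_ne_zero
  have hGpos : 0 < G := log_two_mul_andersonKappa_sub_one_pos μ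
  have hκ := two_le_andersonKappa μ
  have hD : (0 : ℝ) ≤ 2 * andersonKappa μ - 2 := by linarith
  have hmeas : Measurable fun y : Fin N → ℝ =>
      Real.log ‖Matrix.toEuclideanLin (andersonTransferProd E (padSeq y) N) u‖ :=
    (Continuous.log (continuous_andersonTransferProd_apply E N u).norm fun y =>
      (norm_toEuclideanLin_pos_of_det_eq_one _ (det_andersonTransferProd _ _ _) hu0).ne').measurable
  have hb : ∀ᵐ y ∂P, Real.log ‖Matrix.toEuclideanLin (andersonTransferProd E (padSeq y) N) u‖ ∈
      Set.Icc (-((N : ℝ) * G)) ((N : ℝ) * G) :=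
    (ae_pi_abs_le (ae_abs_le_andersonKappa_sub_two μ hcpt) N).mono fun y hy => by
      have := abs_log_norm_apply_le E hD (padSeq y) N
        (fun j hj => abs_energy_sub_padSeq_le hE hy j hj) hu
      rw [show 2 * andersonKappa μ - 2 + 1 = 2 * andersonKappa μ - 1 by ring] at this
      exact ⟨by linarith [(abs_le.mp this).1], (abs_le.mp this).2⟩
  have hH := hasSubgaussianMGF_of_mem_Icc hmeas.aemeasurable hb
  have hint := hH.integrable_exp_mul t
  have hNG : 0 ≤ (N : ℝ) * G := mul_nonneg (Nat.cast_nonneg N) hGpos.le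
  have hc : ((((‖(N : ℝ) * G - -((N : ℝ) * G)‖₊ / 2) ^ 2 : ℝ≥0)) : ℝ) = ((N : ℝ) * G) ^ 2 := by
    rw [NNReal.coe_pow, NNReal.coe_div, coe_nnnorm, Real.norm_eq_abs,
      abs_of_nonneg (by linarith)]
    push_cast
    ring
  calc ∫⁻ y, ENNReal.ofReal (Real.exp (t *
        (Real.log ‖Matrix.toEuclideanLin (andersonTransferProd E (padSeq y) N) u‖ -
          andersonBlockMean μ E N u))) ∂P
      = ∫⁻ y, ENNReal.ofReal ((fun y => Real.exp (t *
          ((fun y => Real.log ‖Matrix.toEuclideanLin (andersonTransferProd E (padSeq y) N) u‖ -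
            ∫ x, Real.log ‖Matrix.toEuclideanLin (andersonTransferProd E (padSeq x) N) u‖ ∂P) y))) y) ∂P :=
        rfl
    _ = ENNReal.ofReal (∫ y, (fun y => Real.exp (t *
          ((fun y => Real.log ‖Matrix.toEuclideanLin (andersonTransferProd E (padSeq y) N) u‖ -
            ∫ x, Real.log ‖Matrix.toEuclideanLin (andersonTransferProd E (padSeq x) N) u‖ ∂P) y))) y ∂P) :=
        (ofReal_integral_eq_lintegral_ofReal hint (ae_of_all _ fun y => (Real.exp_pos _).le)).symm
    _ ≤ ENNReal.ofReal (Real.exp (((‖(N : ℝ) * G - -((N : ℝ) * G)‖₊ / 2) ^ 2 : ℝ≥0) * t ^ 2 / 2)) :=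
        ENNReal.ofReal_le_ofReal (hH.mgf_le t)
    _ = ENNReal.ofReal (Real.exp (((N : ℝ) * G) ^ 2 * t ^ 2 / 2)) := by rw [hc]

/-- **The moment-generating function of the centred block sum** (Azuma–Hoeffding by peeling off
the last block with Tonelli and the one-block Hoeffding lemma):
`∫ exp(t S_P) dμ^{⊗NP} ≤ exp(P (N log(2κ-1))² t²/2)` for every real `t`. [folklore] -/
theorem lintegral_exp_blockSum_le (μ : Measure ℝ) [IsProbabilityMeasure μ] (hcpt : IsCompact μ.support)
    {E : ℝ} (hE : E ∈ Set.Icc (-andersonKappa μ) (andersonKappa μ)) (N : ℕ)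
    {v : EuclideanSpace ℝ (Fin 2)} (hv : ‖v‖ = 1) (t : ℝ) :
    ∀ P : ℕ, ∫⁻ α, ENNReal.ofReal (Real.exp (t * andersonBlockSum μ E N v (padSeq α) P))
        ∂(Measure.pi fun _ : Fin (N * P) => μ) ≤
      ENNReal.ofReal (Real.exp (P * ((N : ℝ) * Real.log (2 * andersonKappa μ - 1)) ^ 2 * t ^ 2 / 2))
  | 0 => by simp [andersonBlockSum]
  | P + 1 => by
    have hv0 : v ≠ 0 := by rw [← norm_ne_zero_iff, hv]; exact one_ne_zero
    set c := ((N : ℝ) * Real.log (2 * andersonKappa μ - 1)) ^ 2 with hc_def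
    have IH := lintegral_exp_blockSum_le μ hcpt hE N hv t P
    have hF : Measurable fun z : Fin (N * P + N) → ℝ =>
        ENNReal.ofReal (Real.exp (t * andersonBlockSum μ E N v (padSeq z) (P + 1))) :=
      ENNReal.measurable_ofReal.comp (Real.measurable_exp.comp
        ((measurable_andersonBlockSum_padSeq μ E N hv0 (P + 1)).const_mul t))
    show ∫⁻ z, ENNReal.ofReal (Real.exp (t * andersonBlockSum μ E N v (padSeq z) (P + 1)))
        ∂(Measure.pi fun _ : Fin (N * P + N) => μ) ≤ _
    rw [lintegral_pi_fin_add μ (N * P) N hF]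
    set u : (Fin (N * P) → ℝ) → EuclideanSpace ℝ (Fin 2) := fun x => andersonDir E (padSeq x) (N * P) v
      with hu_def
    have hsplit : ∀ (x : Fin (N * P) → ℝ) (y : Fin N → ℝ),
        ENNReal.ofReal (Real.exp (t * andersonBlockSum μ E N v (padSeq (Fin.append x y)) (P + 1))) =
          ENNReal.ofReal (Real.exp (t * andersonBlockSum μ E N v (padSeq x) P)) *
            ENNReal.ofReal (Real.exp (t *
              (Real.log ‖Matrix.toEuclideanLin (andersonTransferProd E (padSeq y) N) (u x)‖ -
                andersonBlockMean μ E N (u x)))) := fun x y => by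
      rw [andersonBlockSum_succ_append, mul_add, Real.exp_add, ENNReal.ofReal_mul (Real.exp_pos _).le]
    simp_rw [hsplit]
    have hmeasB : ∀ x : Fin (N * P) → ℝ, Measurable fun y : Fin N → ℝ =>
        ENNReal.ofReal (Real.exp (t *
          (Real.log ‖Matrix.toEuclideanLin (andersonTransferProd E (padSeq y) N) (u x)‖ -
            andersonBlockMean μ E N (u x)))) := fun x => by
      have hux : u x ≠ 0 := andersonDir_ne_zero E _ _ hv0
      refine ENNReal.measurable_ofReal.comp (Real.measurable_exp.comp (Measurable.const_mul ?_ t))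
      exact ((Continuous.log (continuous_andersonTransferProd_apply E N (u x)).norm fun y =>
        (norm_toEuclideanLin_pos_of_det_eq_one _ (det_andersonTransferProd _ _ _)
          hux).ne').measurable).sub_const _
    have hinner : ∀ x : Fin (N * P) → ℝ,
        ∫⁻ y, ENNReal.ofReal (Real.exp (t * andersonBlockSum μ E N v (padSeq x) P)) *
            ENNReal.ofReal (Real.exp (t *
              (Real.log ‖Matrix.toEuclideanLin (andersonTransferProd E (padSeq y) N) (u x)‖ -
                andersonBlockMean μ E N (u x)))) ∂(Measure.pi fun _ : Fin N => μ) ≤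
          ENNReal.ofReal (Real.exp (t * andersonBlockSum μ E N v (padSeq x) P)) *
            ENNReal.ofReal (Real.exp (c * t ^ 2 / 2)) := fun x => by
      rw [lintegral_const_mul _ (hmeasB x)]
      have := lintegral_exp_centered_blockLog_le μ hcpt hE N
        (norm_andersonDir E (padSeq x) (N * P) hv0) t
      gcongr
    have hmeasA : Measurable fun x : Fin (N * P) → ℝ =>
        ENNReal.ofReal (Real.exp (t * andersonBlockSum μ E N v (padSeq x) P)) :=
      ENNReal.measurable_ofReal.comp (Real.measurable_exp.comp
        ((measurable_andersonBlockSum_padSeq μ E N hv0 P).const_mul t))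
    calc ∫⁻ x, ∫⁻ y, ENNReal.ofReal (Real.exp (t * andersonBlockSum μ E N v (padSeq x) P)) *
            ENNReal.ofReal (Real.exp (t *
              (Real.log ‖Matrix.toEuclideanLin (andersonTransferProd E (padSeq y) N) (u x)‖ -
                andersonBlockMean μ E N (u x)))) ∂(Measure.pi fun _ : Fin N => μ)
            ∂(Measure.pi fun _ : Fin (N * P) => μ)
        ≤ ∫⁻ x, ENNReal.ofReal (Real.exp (t * andersonBlockSum μ E N v (padSeq x) P)) *
            ENNReal.ofReal (Real.exp (c * t ^ 2 / 2)) ∂(Measure.pi fun _ : Fin (N * P) => μ) :=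
          lintegral_mono hinner
      _ = (∫⁻ x, ENNReal.ofReal (Real.exp (t * andersonBlockSum μ E N v (padSeq x) P))
            ∂(Measure.pi fun _ : Fin (N * P) => μ)) * ENNReal.ofReal (Real.exp (c * t ^ 2 / 2)) :=
          lintegral_mul_const _ hmeasA
      _ ≤ ENNReal.ofReal (Real.exp (P * c * t ^ 2 / 2)) *
            ENNReal.ofReal (Real.exp (c * t ^ 2 / 2)) := by
          gcongr
      _ = ENNReal.ofReal (Real.exp (((P + 1 : ℕ) : ℝ) * c * t ^ 2 / 2)) := by
          rw [← ENNReal.ofReal_mul (Real.exp_pos _).le, ← Real.exp_add]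
          congr 1
          push_cast
          ring

/-- **`S_P` is sub-Gaussian with variance proxy `P (N log(2κ-1))²`** under `μ^{⊗NP}`
(hence a two-sided Chernoff bound). [folklore] -/
theorem hasSubgaussianMGF_blockSum (μ : Measure ℝ) [IsProbabilityMeasure μ] (hcpt : IsCompact μ.support)
    {E : ℝ} (hE : E ∈ Set.Icc (-andersonKappa μ) (andersonKappa μ)) (N : ℕ)
    {v : EuclideanSpace ℝ (Fin 2)} (hv : ‖v‖ = 1) (P : ℕ) :
    HasSubgaussianMGF (fun α : Fin (N * P) → ℝ => andersonBlockSum μ E N v (padSeq α) P)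
      ⟨P * ((N : ℝ) * Real.log (2 * andersonKappa μ - 1)) ^ 2, by positivity⟩
      (Measure.pi fun _ : Fin (N * P) => μ) := by
  have hv0 : v ≠ 0 := by rw [← norm_ne_zero_iff, hv]; exact one_ne_zero
  have hmeas : Measurable fun α : Fin (N * P) → ℝ => andersonBlockSum μ E N v (padSeq α) P :=
    measurable_andersonBlockSum_padSeq μ E N hv0 P
  have hm : ∀ t : ℝ, AEStronglyMeasurable
      (fun α : Fin (N * P) → ℝ => Real.exp (t * andersonBlockSum μ E N v (padSeq α) P))
      (Measure.pi fun _ : Fin (N * P) => μ) := fun t =>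
    (Real.measurable_exp.comp (hmeas.const_mul t)).aestronglyMeasurable
  refine ⟨fun t => ⟨hm t, ?_⟩, fun t => ?_⟩
  · rw [hasFiniteIntegral_iff_ofReal (ae_of_all _ fun α => (Real.exp_pos _).le)]
    exact (lintegral_exp_blockSum_le μ hcpt hE N hv t P).trans_lt ENNReal.ofReal_lt_top
  · simp only [mgf]
    rw [integral_eq_lintegral_of_nonneg_ae (ae_of_all _ fun α => (Real.exp_pos _).le) (hm t)]
    refine ENNReal.toReal_le_of_le_ofReal (Real.exp_pos _).le ?_
    exact lintegral_exp_blockSum_le μ hcpt hE N hv t P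

/-- **Two-sided tail of the centred block sum**: `μ^{⊗NP}{|S_P| ≥ a} ≤ 2 exp(-a²/(2P(N log(2κ-1))²))`.
[folklore] -/
theorem measure_abs_blockSum_ge_le (μ : Measure ℝ) [IsProbabilityMeasure μ] (hcpt : IsCompact μ.support)
    {E : ℝ} (hE : E ∈ Set.Icc (-andersonKappa μ) (andersonKappa μ)) (N : ℕ)
    {v : EuclideanSpace ℝ (Fin 2)} (hv : ‖v‖ = 1) (P : ℕ) {a : ℝ} (ha : 0 ≤ a) :
    (Measure.pi fun _ : Fin (N * P) => μ) {α | a ≤ |andersonBlockSum μ E N v (padSeq α) P|} ≤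
      ENNReal.ofReal (2 * Real.exp (-a ^ 2 /
        (2 * (P * ((N : ℝ) * Real.log (2 * andersonKappa μ - 1)) ^ 2)))) := by
  set Pm := Measure.pi fun _ : Fin (N * P) => μ with hPm_def
  have h := hasSubgaussianMGF_blockSum μ hcpt hE N hv P
  have h1 : Pm.real {α | a ≤ andersonBlockSum μ E N v (padSeq α) P} ≤
      Real.exp (-a ^ 2 / (2 * (P * ((N : ℝ) * Real.log (2 * andersonKappa μ - 1)) ^ 2))) :=
    h.measure_ge_le ha
  have h2 : Pm.real {α | a ≤ -andersonBlockSum μ E N v (padSeq α) P} ≤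
      Real.exp (-a ^ 2 / (2 * (P * ((N : ℝ) * Real.log (2 * andersonKappa μ - 1)) ^ 2))) :=
    h.neg.measure_ge_le ha
  have hsub : {α : Fin (N * P) → ℝ | a ≤ |andersonBlockSum μ E N v (padSeq α) P|} ⊆
      {α | a ≤ andersonBlockSum μ E N v (padSeq α) P} ∪
        {α | a ≤ -andersonBlockSum μ E N v (padSeq α) P} := fun α hα => by
    simp only [Set.mem_setOf_eq, Set.mem_union] at hα ⊢
    rcases le_abs'.mp hα with h | h
    · right; linarith
    · left; exact h
  calc Pm {α | a ≤ |andersonBlockSum μ E N v (padSeq α) P|}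
      ≤ Pm ({α | a ≤ andersonBlockSum μ E N v (padSeq α) P} ∪
          {α | a ≤ -andersonBlockSum μ E N v (padSeq α) P}) := measure_mono hsub
    _ ≤ Pm {α | a ≤ andersonBlockSum μ E N v (padSeq α) P} +
          Pm {α | a ≤ -andersonBlockSum μ E N v (padSeq α) P} := measure_union_le _ _
    _ = ENNReal.ofReal (Pm.real {α | a ≤ andersonBlockSum μ E N v (padSeq α) P}) +
          ENNReal.ofReal (Pm.real {α | a ≤ -andersonBlockSum μ E N v (padSeq α) P}) := by
        rw [ofReal_measureReal, ofReal_measureReal]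
    _ ≤ ENNReal.ofReal (Real.exp (-a ^ 2 /
          (2 * (P * ((N : ℝ) * Real.log (2 * andersonKappa μ - 1)) ^ 2)))) +
        ENNReal.ofReal (Real.exp (-a ^ 2 /
          (2 * (P * ((N : ℝ) * Real.log (2 * andersonKappa μ - 1)) ^ 2)))) :=
        add_le_add (ENNReal.ofReal_le_ofReal h1) (ENNReal.ofReal_le_ofReal h2)
    _ = _ := by rw [← ENNReal.ofReal_add (Real.exp_pos _).le (Real.exp_pos _).le, ← two_mul]

/-! ### From uniform convergence of the block means to the vectorwise LDT -/

/-- The deviation event of `S_P` is a cylinder over the first `NP` sites. [folklore] -/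
theorem measure_blockSum_cylinder (μ : Measure ℝ) [IsProbabilityMeasure μ] (E : ℝ) (N : ℕ)
    {v : EuclideanSpace ℝ (Fin 2)} (hv0 : v ≠ 0) (P r : ℕ) (a : ℝ) :
    (Measure.pi fun _ : Fin (N * P + r) => μ) {z | a ≤ |andersonBlockSum μ E N v (padSeq z) P|} =
      (Measure.pi fun _ : Fin (N * P) => μ) {x | a ≤ |andersonBlockSum μ E N v (padSeq x) P|} := by
  have hmp := measurePreserving_finAppend μ (N * P) r
  have hmeasB : MeasurableSet
      {z : Fin (N * P + r) → ℝ | a ≤ |andersonBlockSum μ E N v (padSeq z) P|} :=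
    measurableSet_le measurable_const
      (continuous_abs.measurable.comp (measurable_andersonBlockSum_padSeq μ E N hv0 P))
  rw [← hmp.measure_preimage hmeasB.nullMeasurableSet]
  have hpre : (fun w : (Fin (N * P) → ℝ) × (Fin r → ℝ) => Fin.append w.1 w.2) ⁻¹'
      {z | a ≤ |andersonBlockSum μ E N v (padSeq z) P|} =
        {x | a ≤ |andersonBlockSum μ E N v (padSeq x) P|} ×ˢ Set.univ := by
    ext ⟨x, y⟩
    simp only [Set.mem_preimage, Set.mem_setOf_eq, Set.mem_prod, Set.mem_univ, and_true]
    rw [andersonBlockSum_congr μ E N v P fun j hj => padSeq_append_of_lt x y hj]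
  rw [hpre, Measure.prod_prod, measure_univ, mul_one]

/-- **One scale**: if the block means at length `N` are `ε/2`-close to `N·L(E)` uniformly in the
entrance direction, then for `n = NP + r` (`r < N`, `P ≥ 1`, `P ε ≥ 8 log(2κ-1)`) and every unit `v`
`μ^{⊗n}{|n⁻¹ log ‖M_n v‖ - L(E)| ≥ ε} ≤ 2 exp(-P ε²/(32 log²(2κ-1)))`: the deviation forces
`|S_P| ≥ NPε/4` (telescoping, block bounds, `0 ≤ L ≤ log(2κ-1)`), and `S_P` is sub-Gaussian.
[folklore] -/
theorem measure_andersonVectorLDSet_le_of_blockMeans (μ : Measure ℝ) [IsProbabilityMeasure μ]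
    (hcpt : IsCompact μ.support) {E : ℝ} (hE : E ∈ Set.Icc (-andersonKappa μ) (andersonKappa μ))
    {N : ℕ} (hN : 1 ≤ N) {ε : ℝ} (hε : 0 < ε)
    (hU : ∀ u : EuclideanSpace ℝ (Fin 2), ‖u‖ = 1 →
      |1 / (N : ℝ) * andersonBlockMean μ E N u - andersonLyapunov μ E| ≤ ε / 2)
    {P : ℕ} (hP1 : 1 ≤ P) (hP : 8 * Real.log (2 * andersonKappa μ - 1) ≤ P * ε) {r : ℕ} (hr : r < N)
    {v : EuclideanSpace ℝ (Fin 2)} (hv : ‖v‖ = 1) :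
    (Measure.pi fun _ : Fin (N * P + r) => μ) (andersonVectorLDSet μ E ε (N * P + r) v) ≤
      ENNReal.ofReal (2 * Real.exp (-(P * ε ^ 2 / (32 * Real.log (2 * andersonKappa μ - 1) ^ 2)))) := by
  set G := Real.log (2 * andersonKappa μ - 1) with hG_def
  set L := andersonLyapunov μ E with hL_def
  have hv0 : v ≠ 0 := by rw [← norm_ne_zero_iff, hv]; exact one_ne_zero
  have hGpos : 0 < G := log_two_mul_andersonKappa_sub_one_pos μ
  have hκ := two_le_andersonKappa μ
  have hD : (0 : ℝ) ≤ 2 * andersonKappa μ - 2 := by linarith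
  have hL0 : 0 ≤ L := andersonLyapunov_nonneg μ E
  have hLG : L ≤ G := andersonLyapunov_le_log μ hcpt hE
  have hNpos : (0 : ℝ) < N := by exact_mod_cast hN
  have hPpos : (0 : ℝ) < P := by exact_mod_cast hP1
  have hnNP : (N : ℝ) * P ≤ ((N * P + r : ℕ) : ℝ) := by
    push_cast; linarith [(Nat.cast_nonneg r : (0 : ℝ) ≤ r)]
  have hnpos : (0 : ℝ) < ((N * P + r : ℕ) : ℝ) := lt_of_lt_of_le (by positivity) hnNP
  set a : ℝ := (N : ℝ) * P * ε / 4 with ha_def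
  have ha0 : 0 ≤ a := by positivity
  -- Step 1: on the support box a deviation forces `|S_P| ≥ a`.
  have hcont : andersonVectorLDSet μ E ε (N * P + r) v ∩ {α | ∀ i, |α i| ≤ andersonKappa μ - 2} ⊆
      {α | a ≤ |andersonBlockSum μ E N v (padSeq α) P|} := by
    rintro α ⟨hα, hbox⟩
    simp only [andersonVectorLDSet, Set.mem_setOf_eq] at hα hbox ⊢
    have hβD : ∀ k, |E - padSeq α k| ≤ 2 * andersonKappa μ - 2 :=
      abs_energy_sub_padSeq_le_all hE hbox
    have htel := log_norm_transferProd_add_apply E (padSeq α) (N * P) r hv0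
    have hblocks := log_norm_transferProd_blocks E N (padSeq α) hv P
    have hsum : ∑ p ∈ Finset.range P, andersonBlockLog E N v (padSeq α) p =
        andersonBlockSum μ E N v (padSeq α) P +
          ∑ p ∈ Finset.range P, andersonBlockMean μ E N (andersonDir E (padSeq α) (N * p) v) := by
      unfold andersonBlockSum
      rw [Finset.sum_sub_distrib]
      ring
    have hrem : |Real.log ‖Matrix.toEuclideanLin
        (andersonTransferProd E (fun j => padSeq α (N * P + j)) r)
          (andersonDir E (padSeq α) (N * P) v)‖| ≤ r * G := by
      have := abs_log_norm_apply_le E hD (fun j => padSeq α (N * P + j)) r (fun j _ => hβD _)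
        (norm_andersonDir E (padSeq α) (N * P) hv0)
      rwa [show 2 * andersonKappa μ - 2 + 1 = 2 * andersonKappa μ - 1 by ring] at this
    have hterm : ∀ p ∈ Finset.range P,
        |andersonBlockMean μ E N (andersonDir E (padSeq α) (N * p) v) - N * L| ≤ N * (ε / 2) := by
      intro p _
      have h := hU _ (norm_andersonDir E (padSeq α) (N * p) hv0)
      have heq : andersonBlockMean μ E N (andersonDir E (padSeq α) (N * p) v) - N * L =
          N * (1 / (N : ℝ) * andersonBlockMean μ E N (andersonDir E (padSeq α) (N * p) v) - L) := by
        field_simp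
      rw [heq, abs_mul, abs_of_pos hNpos]
      exact mul_le_mul_of_nonneg_left h hNpos.le
    have hmeans : |∑ p ∈ Finset.range P,
        andersonBlockMean μ E N (andersonDir E (padSeq α) (N * p) v) - P * (N * L)| ≤
        P * (N * (ε / 2)) := by
      have hrw : ∑ p ∈ Finset.range P,
          andersonBlockMean μ E N (andersonDir E (padSeq α) (N * p) v) - P * (N * L) =
          ∑ p ∈ Finset.range P,
            (andersonBlockMean μ E N (andersonDir E (padSeq α) (N * p) v) - N * L) := by
        rw [Finset.sum_sub_distrib, Finset.sum_const, Finset.card_range, nsmul_eq_mul]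
      rw [hrw]
      calc _ ≤ ∑ p ∈ Finset.range P,
            |andersonBlockMean μ E N (andersonDir E (padSeq α) (N * p) v) - N * L| :=
            Finset.abs_sum_le_sum_abs _ _
        _ ≤ (Finset.range P).card • (N * (ε / 2)) := Finset.sum_le_card_nsmul _ _ _ hterm
        _ = P * (N * (ε / 2)) := by rw [Finset.card_range, nsmul_eq_mul]
    have hrL : (r : ℝ) * L ≤ N * G := by
      have : (r : ℝ) ≤ N := by exact_mod_cast hr.le
      calc (r : ℝ) * L ≤ N * L := mul_le_mul_of_nonneg_right this hL0
        _ ≤ N * G := mul_le_mul_of_nonneg_left hLG hNpos.le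
    have hrG : (r : ℝ) * G ≤ N * G :=
      mul_le_mul_of_nonneg_right (by exact_mod_cast hr.le) hGpos.le
    have hdev : ((N * P + r : ℕ) : ℝ) * ε ≤
        |Real.log ‖Matrix.toEuclideanLin (andersonTransferProd E (padSeq α) (N * P + r)) v‖ -
          ((N * P + r : ℕ) : ℝ) * L| := by
      have h1 : 1 / ((N * P + r : ℕ) : ℝ) *
          Real.log ‖Matrix.toEuclideanLin (andersonTransferProd E (padSeq α) (N * P + r)) v‖ - L =
          1 / ((N * P + r : ℕ) : ℝ) *
            (Real.log ‖Matrix.toEuclideanLin (andersonTransferProd E (padSeq α) (N * P + r)) v‖ -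
              ((N * P + r : ℕ) : ℝ) * L) := by
        field_simp
      rw [h1, abs_mul, abs_of_pos (by positivity)] at hα
      have := mul_le_mul_of_nonneg_left hα hnpos.le
      rwa [← mul_assoc, mul_one_div_cancel hnpos.ne', one_mul] at this
    have hkey : Real.log ‖Matrix.toEuclideanLin (andersonTransferProd E (padSeq α) (N * P + r)) v‖ -
        ((N * P + r : ℕ) : ℝ) * L =
        andersonBlockSum μ E N v (padSeq α) P +
          (∑ p ∈ Finset.range P, andersonBlockMean μ E N (andersonDir E (padSeq α) (N * p) v) -
            P * (N * L)) +
          (Real.log ‖Matrix.toEuclideanLin (andersonTransferProd E (fun j => padSeq α (N * P + j)) r)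
            (andersonDir E (padSeq α) (N * P) v)‖ - r * L) := by
      rw [htel, hblocks, hsum]
      push_cast
      ring
    rw [hkey] at hdev
    have hB : |Real.log ‖Matrix.toEuclideanLin (andersonTransferProd E (fun j => padSeq α (N * P + j)) r)
        (andersonDir E (padSeq α) (N * P) v)‖ - r * L| ≤ 2 * (N * G) := by
      calc _ ≤ |Real.log ‖Matrix.toEuclideanLin
                (andersonTransferProd E (fun j => padSeq α (N * P + j)) r)
              (andersonDir E (padSeq α) (N * P) v)‖| + |(r : ℝ) * L| := abs_sub _ _
        _ ≤ r * G + r * L := add_le_add hrem (by rw [abs_of_nonneg (by positivity)])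
        _ ≤ N * G + N * G := add_le_add hrG hrL
        _ = 2 * (N * G) := by ring
    have habs : ((N * P + r : ℕ) : ℝ) * ε ≤
        |andersonBlockSum μ E N v (padSeq α) P| + P * (N * (ε / 2)) + 2 * (N * G) := by
      calc ((N * P + r : ℕ) : ℝ) * ε ≤ _ := hdev
        _ ≤ |andersonBlockSum μ E N v (padSeq α) P +
              (∑ p ∈ Finset.range P, andersonBlockMean μ E N (andersonDir E (padSeq α) (N * p) v) -
                P * (N * L))| +
            |Real.log ‖Matrix.toEuclideanLin (andersonTransferProd E (fun j => padSeq α (N * P + j)) r)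
              (andersonDir E (padSeq α) (N * P) v)‖ - r * L| := abs_add_le _ _
        _ ≤ |andersonBlockSum μ E N v (padSeq α) P| +
              |∑ p ∈ Finset.range P, andersonBlockMean μ E N (andersonDir E (padSeq α) (N * p) v) -
                P * (N * L)| +
            |Real.log ‖Matrix.toEuclideanLin (andersonTransferProd E (fun j => padSeq α (N * P + j)) r)
              (andersonDir E (padSeq α) (N * P) v)‖ - r * L| := by
            gcongr
            exact abs_add_le _ _
        _ ≤ _ := by gcongr
    have h8 : 2 * ((N : ℝ) * G) ≤ a := by
      rw [ha_def]
      have := mul_le_mul_of_nonneg_left hP hNpos.le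
      linarith
    have hnε : (N : ℝ) * P * ε ≤ ((N * P + r : ℕ) : ℝ) * ε := by
      have := mul_le_mul_of_nonneg_right hnNP hε.le
      linarith
    rw [ha_def] at h8 ⊢
    linarith
  -- Step 2: the box is conull, the event is a cylinder, and `S_P` has sub-Gaussian tails.
  have hbox : ∀ᵐ α ∂(Measure.pi fun _ : Fin (N * P + r) => μ), ∀ i, |α i| ≤ andersonKappa μ - 2 :=
    ae_pi_abs_le (ae_abs_le_andersonKappa_sub_two μ hcpt) (N * P + r)
  have hnull : (Measure.pi fun _ : Fin (N * P + r) => μ)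
      {α : Fin (N * P + r) → ℝ | ∀ i, |α i| ≤ andersonKappa μ - 2}ᶜ = 0 :=
    mem_ae_iff.mp hbox
  calc (Measure.pi fun _ : Fin (N * P + r) => μ) (andersonVectorLDSet μ E ε (N * P + r) v)
      = (Measure.pi fun _ : Fin (N * P + r) => μ)
          (andersonVectorLDSet μ E ε (N * P + r) v ∩ {α | ∀ i, |α i| ≤ andersonKappa μ - 2}) :=
        (measure_inter_conull hnull).symm
    _ ≤ (Measure.pi fun _ : Fin (N * P + r) => μ)
          {α | a ≤ |andersonBlockSum μ E N v (padSeq α) P|} := measure_mono hcont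
    _ = (Measure.pi fun _ : Fin (N * P) => μ) {x | a ≤ |andersonBlockSum μ E N v (padSeq x) P|} :=
        measure_blockSum_cylinder μ E N hv0 P r a
    _ ≤ ENNReal.ofReal (2 * Real.exp (-a ^ 2 / (2 * (P * ((N : ℝ) * G) ^ 2)))) :=
        measure_abs_blockSum_ge_le μ hcpt hE N hv P ha0
    _ = ENNReal.ofReal (2 * Real.exp (-(P * ε ^ 2 / (32 * G ^ 2)))) := by
        congr 3
        rw [ha_def]
        field_simp
        ring

/-- **The vectorwise uniform LDT from uniform convergence of the block means** (for one single-site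
law): if for every `ε > 0` there is a block length `N` at which the block means
`N⁻¹ ∫ log ‖M_N^E u‖ dμ^{⊗N}` are `ε`-close to `L(E)` uniformly in the unit vector `u` and in
`E ∈ Σ̂`, then for every `ε > 0` there are `C, η > 0` with
`μ^{⊗n}{|n⁻¹ log ‖M_n^E v‖ - L(E)| ≥ ε} ≤ C e^{-ηn}` for all `n ≥ 1`, unit `v`, `E ∈ Σ̂`
(`η = ε²/(32 N log²(2κ-1))` with `N = N(ε/2)`). [folklore] -/
theorem andersonVectorLDT_of_blockMeans (μ : Measure ℝ) [IsProbabilityMeasure μ]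
    (hcpt : IsCompact μ.support)
    (hU : ∀ ε : ℝ, 0 < ε → ∃ N : ℕ, 1 ≤ N ∧ ∀ u : EuclideanSpace ℝ (Fin 2), ‖u‖ = 1 →
      ∀ E ∈ Set.Icc (-andersonKappa μ) (andersonKappa μ),
        |1 / (N : ℝ) * andersonBlockMean μ E N u - andersonLyapunov μ E| ≤ ε)
    {ε : ℝ} (hε : 0 < ε) :
    ∃ C η : ℝ, 0 < C ∧ 0 < η ∧ ∀ n : ℕ, 1 ≤ n → ∀ v : EuclideanSpace ℝ (Fin 2), ‖v‖ = 1 →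
      ∀ E ∈ Set.Icc (-andersonKappa μ) (andersonKappa μ),
        (Measure.pi fun _ : Fin n => μ) (andersonVectorLDSet μ E ε n v) ≤
          ENNReal.ofReal (C * Real.exp (-(η * n))) := by
  obtain ⟨N, hN, hUN⟩ := hU (ε / 2) (half_pos hε)
  set G := Real.log (2 * andersonKappa μ - 1) with hG_def
  have hGpos : 0 < G := log_two_mul_andersonKappa_sub_one_pos μ
  have hNpos : (0 : ℝ) < N := by exact_mod_cast hN
  have hNpos' : 0 < N := hN
  set P₀ : ℕ := ⌈8 * G / ε⌉₊ + 1 with hP₀_def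
  set η : ℝ := ε ^ 2 / (32 * G ^ 2 * N) with hη_def
  have hηpos : 0 < η := by positivity
  set C₁ : ℝ := 2 * Real.exp (ε ^ 2 / (32 * G ^ 2)) with hC₁_def
  have hC₁ : 0 < C₁ := by positivity
  refine ⟨C₁ + Real.exp (η * ((N * P₀ : ℕ) : ℝ)), η, by positivity, hηpos, fun n hn v hv E hE => ?_⟩
  have hexp : 0 < Real.exp (-(η * n)) := Real.exp_pos _
  rcases lt_or_ge n (N * P₀) with hsmall | hlarge
  · have hone : 1 ≤ Real.exp (η * ((N * P₀ : ℕ) : ℝ)) * Real.exp (-(η * n)) := by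
      rw [← Real.exp_add]
      apply Real.one_le_exp
      have : (n : ℝ) < ((N * P₀ : ℕ) : ℝ) := by exact_mod_cast hsmall
      nlinarith
    calc (Measure.pi fun _ : Fin n => μ) (andersonVectorLDSet μ E ε n v) ≤ 1 := prob_le_one
      _ = ENNReal.ofReal 1 := ENNReal.ofReal_one.symm
      _ ≤ _ := ENNReal.ofReal_le_ofReal (by nlinarith [hC₁.le])
  · have hP : P₀ ≤ n / N := (Nat.le_div_iff_mul_le hNpos').mpr (by rw [mul_comm]; exact hlarge)
    have hP1 : 1 ≤ n / N := le_trans (by omega) hP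
    have hPε : 8 * G ≤ ((n / N : ℕ) : ℝ) * ε := by
      have h1 : 8 * G / ε ≤ ⌈8 * G / ε⌉₊ := Nat.le_ceil _
      have h2 : (⌈8 * G / ε⌉₊ : ℝ) + 1 ≤ ((n / N : ℕ) : ℝ) := by exact_mod_cast hP
      rw [div_le_iff₀ hε] at h1
      nlinarith
    have hr : n % N < N := Nat.mod_lt n hNpos'
    have key := measure_andersonVectorLDSet_le_of_blockMeans μ hcpt hE hN hε
      (fun u hu => hUN u hu E hE) hP1 hPε hr hv
    rw [Nat.div_add_mod n N] at key
    refine key.trans (ENNReal.ofReal_le_ofReal ?_)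
    have hPreal : (n : ℝ) / N - 1 ≤ ((n / N : ℕ) : ℝ) := by
      have h := Nat.div_add_mod n N
      have hcast : (N : ℝ) * ((n / N : ℕ) : ℝ) + ((n % N : ℕ) : ℝ) = n := by exact_mod_cast h
      have hmod : ((n % N : ℕ) : ℝ) < N := by exact_mod_cast hr
      rw [sub_le_iff_le_add, div_le_iff₀ hNpos]
      nlinarith
    have hexp_le : Real.exp (-(((n / N : ℕ) : ℝ) * ε ^ 2 / (32 * G ^ 2))) ≤
        Real.exp (ε ^ 2 / (32 * G ^ 2)) * Real.exp (-(η * n)) := by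
      rw [← Real.exp_add]
      apply Real.exp_le_exp.mpr
      rw [hη_def]
      have h32 : (0 : ℝ) < 32 * G ^ 2 := by positivity
      have key2 : ((n : ℝ) / N - 1) * ε ^ 2 / (32 * G ^ 2) ≤
          ((n / N : ℕ) : ℝ) * ε ^ 2 / (32 * G ^ 2) := by
        apply div_le_div_of_nonneg_right _ h32.le
        exact mul_le_mul_of_nonneg_right hPreal (by positivity)
      have hsplit : ((n : ℝ) / N - 1) * ε ^ 2 / (32 * G ^ 2) =
          ε ^ 2 / (32 * G ^ 2 * N) * n - ε ^ 2 / (32 * G ^ 2) := by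
        field_simp
      linarith
    calc 2 * Real.exp (-(((n / N : ℕ) : ℝ) * ε ^ 2 / (32 * G ^ 2)))
        ≤ 2 * (Real.exp (ε ^ 2 / (32 * G ^ 2)) * Real.exp (-(η * n))) := by linarith
      _ = C₁ * Real.exp (-(η * n)) := by rw [hC₁_def]; ring
      _ ≤ (C₁ + Real.exp (η * ((N * P₀ : ℕ) : ℝ))) * Real.exp (-(η * n)) := by
          gcongr
          linarith [Real.exp_pos (η * ((N * P₀ : ℕ) : ℝ))]

/-- **Bucaj et al. Prop. 3.6 (vectorwise uniform LDT) from uniform convergence of the block means.**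
The hypothesis — for every `ε > 0` a block length `N` at which `N⁻¹ ∫ log ‖M_N^E u‖ dμ^{⊗N}` is
`ε`-close to `L(E)` uniformly in the unit vector `u` and the energy `E ∈ Σ̂` — is the uniform
convergence statement delivered by Furstenberg–Kifer / Bougerol–Lacroix theory (strong
irreducibility and contraction of `G_{ν_E}`, Thm 2.3 / Prop. 2.9 of the source), and is itself a
consequence of Prop. 3.6.  The implication proved here (block martingale + Hoeffding's lemma)
replaces the Chebyshev-count / `δ^m`-independence argument of the printed proof of Prop. 3.6.
[cite: BucajEtAl2019, Prop. 3.6] -/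
theorem BucajEtAl2019_vectorLDT_of_blockMeans
    (hU : ∀ (μ : Measure ℝ) [IsProbabilityMeasure μ], IsCompact μ.support → μ.support.Nontrivial →
      ∀ ε : ℝ, 0 < ε → ∃ N : ℕ, 1 ≤ N ∧ ∀ u : EuclideanSpace ℝ (Fin 2), ‖u‖ = 1 →
        ∀ E ∈ Set.Icc (-andersonKappa μ) (andersonKappa μ),
          |1 / (N : ℝ) * andersonBlockMean μ E N u - andersonLyapunov μ E| ≤ ε) :
    BucajEtAl2019_vectorLDT := by
  intro μ _ hcpt hnt ε hε
  exact andersonVectorLDT_of_blockMeans μ hcpt (hU μ hcpt hnt) hε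

/-- **Bucaj et al. Thm 3.1 (matrix-norm uniform LDT) from uniform convergence of the block means**,
via `BucajEtAl2019_matrixLDT_of_vectorLDT`. [cite: BucajEtAl2019, Thm 3.1] -/
theorem BucajEtAl2019_matrixLDT_of_blockMeans
    (hU : ∀ (μ : Measure ℝ) [IsProbabilityMeasure μ], IsCompact μ.support → μ.support.Nontrivial →
      ∀ ε : ℝ, 0 < ε → ∃ N : ℕ, 1 ≤ N ∧ ∀ u : EuclideanSpace ℝ (Fin 2), ‖u‖ = 1 →
        ∀ E ∈ Set.Icc (-andersonKappa μ) (andersonKappa μ),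
          |1 / (N : ℝ) * andersonBlockMean μ E N u - andersonLyapunov μ E| ≤ ε) :
    BucajEtAl2019_matrixLDT :=
  BucajEtAl2019_matrixLDT_of_vectorLDT (BucajEtAl2019_vectorLDT_of_blockMeans hU)

/-! ### The hypothesis is necessary -/

/-- **Prop. 3.6 implies the uniform convergence of the block means**: the hypothesis of
`BucajEtAl2019_vectorLDT_of_blockMeans` is a consequence of its conclusion (split
`∫ |N⁻¹ log ‖M_N u‖ - L|` over the deviation event, on which the integrand is `≤ 2 log(2κ-1)`),
so the two statements are equivalent. [folklore] -/
theorem andersonBlockMeans_of_vectorLDT (h : BucajEtAl2019_vectorLDT) (μ : Measure ℝ)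
    [IsProbabilityMeasure μ] (hcpt : IsCompact μ.support) (hnt : μ.support.Nontrivial)
    {ε : ℝ} (hε : 0 < ε) :
    ∃ N : ℕ, 1 ≤ N ∧ ∀ u : EuclideanSpace ℝ (Fin 2), ‖u‖ = 1 →
      ∀ E ∈ Set.Icc (-andersonKappa μ) (andersonKappa μ),
        |1 / (N : ℝ) * andersonBlockMean μ E N u - andersonLyapunov μ E| ≤ ε := by
  obtain ⟨C, η, hC, hη, hV⟩ := h μ hcpt hnt (ε / 2) (half_pos hε)
  set G := Real.log (2 * andersonKappa μ - 1) with hG_def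
  have hGpos : 0 < G := log_two_mul_andersonKappa_sub_one_pos μ
  have hκ := two_le_andersonKappa μ
  have hD : (0 : ℝ) ≤ 2 * andersonKappa μ - 2 := by linarith
  obtain ⟨N, hN1, hN⟩ : ∃ N : ℕ, 1 ≤ N ∧ 2 * G * (C * Real.exp (-(η * N))) ≤ ε / 2 := by
    have hlim : Tendsto (fun N : ℕ => 2 * G * (C * Real.exp (-(η * N)))) atTop
        (nhds (2 * G * (C * 0))) := by
      refine tendsto_const_nhds.mul (tendsto_const_nhds.mul ?_)
      have h1 : Tendsto (fun N : ℕ => η * (N : ℝ)) atTop atTop :=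
        Tendsto.const_mul_atTop hη tendsto_natCast_atTop_atTop
      exact Real.tendsto_exp_neg_atTop_nhds_zero.comp h1
    rw [mul_zero, mul_zero] at hlim
    obtain ⟨N₀, hN₀⟩ := eventually_atTop.mp (hlim.eventually (gt_mem_nhds (half_pos hε)))
    exact ⟨max N₀ 1, le_max_right _ _, (hN₀ _ (le_max_left _ _)).le⟩
  have hNpos : (0 : ℝ) < N := by exact_mod_cast hN1
  refine ⟨N, hN1, fun u hu E hE => ?_⟩
  have hu0 : u ≠ 0 := by rw [← norm_ne_zero_iff, hu]; exact one_ne_zero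
  set Pm := Measure.pi fun _ : Fin N => μ with hPm_def
  set L := andersonLyapunov μ E with hL_def
  have hL0 : 0 ≤ L := andersonLyapunov_nonneg μ E
  have hLG : L ≤ G := andersonLyapunov_le_log μ hcpt hE
  set g : (Fin N → ℝ) → ℝ := fun y =>
    Real.log ‖Matrix.toEuclideanLin (andersonTransferProd E (padSeq y) N) u‖ with hg_def
  have hgm : Measurable g :=
    (Continuous.log (continuous_andersonTransferProd_apply E N u).norm fun y =>
      (norm_toEuclideanLin_pos_of_det_eq_one _ (det_andersonTransferProd _ _ _) hu0).ne').measurable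
  have hgb : ∀ᵐ y ∂Pm, |g y| ≤ N * G :=
    (ae_pi_abs_le (ae_abs_le_andersonKappa_sub_two μ hcpt) N).mono fun y hy => by
      have := abs_log_norm_apply_le E hD (padSeq y) N
        (fun j hj => abs_energy_sub_padSeq_le hE hy j hj) hu
      rwa [show 2 * andersonKappa μ - 2 + 1 = 2 * andersonKappa μ - 1 by ring] at this
  have hgi : Integrable g Pm :=
    Integrable.mono' (integrable_const ((N : ℝ) * G)) hgm.aestronglyMeasurable
      (hgb.mono fun y hy => by rwa [Real.norm_eq_abs])
  set f : (Fin N → ℝ) → ℝ := fun y => 1 / (N : ℝ) * g y - L with hf_def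
  have hfi : Integrable f Pm := (hgi.const_mul _).sub (integrable_const _)
  have hfb : ∀ᵐ y ∂Pm, |f y| ≤ 2 * G := hgb.mono fun y hy => by
    calc |f y| ≤ |1 / (N : ℝ) * g y| + |L| := abs_sub _ _
      _ ≤ G + G := by
          refine add_le_add ?_ (by rw [abs_of_nonneg hL0]; exact hLG)
          rw [abs_mul, abs_of_pos (by positivity)]
          calc 1 / (N : ℝ) * |g y| ≤ 1 / (N : ℝ) * (N * G) :=
                mul_le_mul_of_nonneg_left hy (by positivity)
            _ = G := by field_simp
      _ = 2 * G := by ring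
  have hid : 1 / (N : ℝ) * andersonBlockMean μ E N u - L = ∫ y, f y ∂Pm := by
    rw [hf_def, integral_sub (hgi.const_mul _) (integrable_const _), integral_const_mul,
      integral_const]
    simp [andersonBlockMean, hg_def, hPm_def]
  rw [hid]
  set Dv := andersonVectorLDSet μ E (ε / 2) N u with hDv_def
  have hDm : MeasurableSet Dv := measurableSet_andersonVectorLDSet μ E (ε / 2) N u
  have hptw : ∀ᵐ y ∂Pm, |f y| ≤ ε / 2 + 2 * G * Dv.indicator (fun _ => (1 : ℝ)) y :=
    hfb.mono fun y hy => by
      by_cases hyD : y ∈ Dv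
      · rw [Set.indicator_of_mem hyD, mul_one]; linarith
      · rw [Set.indicator_of_notMem hyD, mul_zero, add_zero]
        have : ¬ (ε / 2 ≤ |f y|) := hyD
        linarith [not_le.mp this]
  have hind : Integrable (fun y => ε / 2 + 2 * G * Dv.indicator (fun _ => (1 : ℝ)) y) Pm :=
    (integrable_const _).add (((integrable_const (1 : ℝ)).indicator hDm).const_mul _)
  have hreal : Pm.real Dv ≤ C * Real.exp (-(η * N)) := by
    have := hV N hN1 u hu E hE
    exact ENNReal.toReal_le_of_le_ofReal (by positivity) this
  calc |∫ y, f y ∂Pm| ≤ ∫ y, |f y| ∂Pm := abs_integral_le_integral_abs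
    _ ≤ ∫ y, (ε / 2 + 2 * G * Dv.indicator (fun _ => (1 : ℝ)) y) ∂Pm :=
        integral_mono_ae hfi.abs hind hptw
    _ = ε / 2 + 2 * G * Pm.real Dv := by
        rw [integral_add (integrable_const _) (((integrable_const (1 : ℝ)).indicator hDm).const_mul _),
          integral_const, integral_const_mul, integral_indicator hDm, setIntegral_const]
        simp
    _ ≤ ε / 2 + 2 * G * (C * Real.exp (-(η * N))) := by gcongr
    _ ≤ ε := by linarith

/-! ### Changing the block length, and locally uniform block means suffice -/

/-- A sub-Gaussian random variable (in the moment-generating-function sense, for ALL real `t`) is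
centred: `1 + t 𝔼X ≤ 𝔼 e^{tX} ≤ e^{ct²/2}` for every `t` forces `𝔼X = 0`. [folklore] -/
theorem integral_eq_zero_of_hasSubgaussianMGF {Ω : Type*} [MeasurableSpace Ω] {P : Measure Ω}
    [IsProbabilityMeasure P] {X : Ω → ℝ} {c : ℝ≥0} (h : HasSubgaussianMGF X c P) :
    ∫ ω, X ω ∂P = 0 := by
  -- the one-sided statement, applied to `X` and `-X`
  have key : ∀ {Y : Ω → ℝ}, HasSubgaussianMGF Y c P → ∫ ω, Y ω ∂P ≤ 0 := by
    intro Y hY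
    set m := ∫ ω, Y ω ∂P with hm_def
    have hlin : ∀ t : ℝ, 1 + t * m ≤ Real.exp (c * t ^ 2 / 2) := fun t => by
      have h1 : ∫ ω, (1 + t * Y ω) ∂P = 1 + t * m := by
        rw [integral_add (integrable_const _) (hY.integrable.const_mul t), integral_const,
          integral_const_mul]
        simp [hm_def]
      have h2 : ∫ ω, (1 + t * Y ω) ∂P ≤ ∫ ω, Real.exp (t * Y ω) ∂P :=
        integral_mono ((integrable_const _).add (hY.integrable.const_mul t))
          (hY.integrable_exp_mul t) fun ω => by
            have := Real.add_one_le_exp (t * Y ω)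
            linarith
      have h3 : ∫ ω, Real.exp (t * Y ω) ∂P ≤ Real.exp (c * t ^ 2 / 2) := hY.mgf_le t
      linarith
    refine le_of_not_gt fun hpos => ?_
    -- choose `t > 0` small
    set t : ℝ := min (1 / ((c : ℝ) + 1)) (m / (2 * ((c : ℝ) + (c : ℝ) ^ 2 + 1))) with ht_def
    have hc0 : (0 : ℝ) ≤ c := c.2
    have ht0 : 0 < t := lt_min (by positivity) (by positivity)
    have ht1 : t ≤ 1 / ((c : ℝ) + 1) := min_le_left _ _
    have ht2 : t ≤ m / (2 * ((c : ℝ) + (c : ℝ) ^ 2 + 1)) := min_le_right _ _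
    have htle1 : t ≤ 1 := ht1.trans (by rw [div_le_one (by positivity)]; linarith)
    have hx1 : |(c : ℝ) * t ^ 2 / 2| ≤ 1 := by
      rw [abs_of_nonneg (by positivity)]
      have : (c : ℝ) * t ≤ 1 := by
        calc (c : ℝ) * t ≤ ((c : ℝ) + 1) * t := by nlinarith
          _ ≤ ((c : ℝ) + 1) * (1 / ((c : ℝ) + 1)) := by gcongr
          _ = 1 := by field_simp
      nlinarith
    have hexp : Real.exp ((c : ℝ) * t ^ 2 / 2) ≤ 1 + (c : ℝ) * t ^ 2 / 2 + ((c : ℝ) * t ^ 2 / 2) ^ 2 := by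
      have := (abs_le.mp (Real.abs_exp_sub_one_sub_id_le hx1)).2
      linarith
    have hmain := hlin t
    -- `t m ≤ c t²/2 + (c t²/2)² ≤ (c + c²) t²` and `t ≤ m/(2(c+c²+1))`
    have h4 : t * m ≤ ((c : ℝ) + (c : ℝ) ^ 2) * t ^ 2 := by
      have : ((c : ℝ) * t ^ 2 / 2) ^ 2 ≤ (c : ℝ) ^ 2 * t ^ 2 := by
        have ht4 : t ^ 4 ≤ t ^ 2 := by nlinarith [pow_le_one₀ ht0.le htle1 (n := 2)]
        nlinarith
      nlinarith
    have h5 : m ≤ ((c : ℝ) + (c : ℝ) ^ 2) * t := by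
      have h4' : t * m ≤ t * (((c : ℝ) + (c : ℝ) ^ 2) * t) := by nlinarith [h4]
      exact le_of_mul_le_mul_left h4' ht0
    have h6 : ((c : ℝ) + (c : ℝ) ^ 2) * t ≤ m / 2 := by
      calc ((c : ℝ) + (c : ℝ) ^ 2) * t ≤ ((c : ℝ) + (c : ℝ) ^ 2 + 1) * t := by nlinarith
        _ ≤ ((c : ℝ) + (c : ℝ) ^ 2 + 1) * (m / (2 * ((c : ℝ) + (c : ℝ) ^ 2 + 1))) := by gcongr
        _ = m / 2 := by field_simp
    linarith
  have h1 := key h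
  have h2 : ∫ ω, -X ω ∂P ≤ 0 := key h.neg
  rw [integral_neg] at h2
  linarith

/-- **The block means are uniformly bounded**: `|g_N(u)| ≤ N log(2κ-1)` for a unit vector `u` and
`E ∈ Σ̂`. [folklore] -/
theorem abs_andersonBlockMean_le (μ : Measure ℝ) [IsProbabilityMeasure μ] (hcpt : IsCompact μ.support)
    {E : ℝ} (hE : E ∈ Set.Icc (-andersonKappa μ) (andersonKappa μ)) (N : ℕ)
    {u : EuclideanSpace ℝ (Fin 2)} (hu : ‖u‖ = 1) :
    |andersonBlockMean μ E N u| ≤ N * Real.log (2 * andersonKappa μ - 1) := by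
  have hκ := two_le_andersonKappa μ
  have hD : (0 : ℝ) ≤ 2 * andersonKappa μ - 2 := by linarith
  have hb : ∀ᵐ y ∂(Measure.pi fun _ : Fin N => μ),
      ‖Real.log ‖Matrix.toEuclideanLin (andersonTransferProd E (padSeq y) N) u‖‖ ≤
        N * Real.log (2 * andersonKappa μ - 1) :=
    (ae_pi_abs_le (ae_abs_le_andersonKappa_sub_two μ hcpt) N).mono fun y hy => by
      have := abs_log_norm_apply_le E hD (padSeq y) N
        (fun j hj => abs_energy_sub_padSeq_le hE hy j hj) hu
      rw [show 2 * andersonKappa μ - 2 + 1 = 2 * andersonKappa μ - 1 by ring] at this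
      rwa [Real.norm_eq_abs]
  have := norm_integral_le_of_norm_le_const hb
  unfold andersonBlockMean
  rw [Real.norm_eq_abs] at this
  simpa using this

/-- **Changing the block length**: if at block length `N` the block means are `ε`-close to `N·L(E)`
uniformly in the entrance direction, then so are the block means at every multiple `NP`
(`P ≥ 1`): `g_{NP}(v) = 𝔼 S_P + Σ_p 𝔼 g_N(u_p)` with `𝔼 S_P = 0`. [folklore] -/
theorem andersonBlockMean_mul_le (μ : Measure ℝ) [IsProbabilityMeasure μ] (hcpt : IsCompact μ.support)
    {E : ℝ} (hE : E ∈ Set.Icc (-andersonKappa μ) (andersonKappa μ)) {N : ℕ} (hN : 1 ≤ N) {ε : ℝ}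
    (hU : ∀ u : EuclideanSpace ℝ (Fin 2), ‖u‖ = 1 →
      |1 / (N : ℝ) * andersonBlockMean μ E N u - andersonLyapunov μ E| ≤ ε)
    {P : ℕ} (hP : 1 ≤ P) {v : EuclideanSpace ℝ (Fin 2)} (hv : ‖v‖ = 1) :
    |1 / ((N * P : ℕ) : ℝ) * andersonBlockMean μ E (N * P) v - andersonLyapunov μ E| ≤ ε := by
  set L := andersonLyapunov μ E with hL_def
  set Pm := Measure.pi fun _ : Fin (N * P) => μ with hPm_def
  have hv0 : v ≠ 0 := by rw [← norm_ne_zero_iff, hv]; exact one_ne_zero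
  have hNpos : (0 : ℝ) < N := by exact_mod_cast hN
  have hPpos : (0 : ℝ) < P := by exact_mod_cast hP
  have hε : 0 ≤ ε := (abs_nonneg _).trans (hU v hv)
  -- pointwise decomposition of the integrand
  have hptw : ∀ α : Fin (N * P) → ℝ,
      Real.log ‖Matrix.toEuclideanLin (andersonTransferProd E (padSeq α) (N * P)) v‖ =
        andersonBlockSum μ E N v (padSeq α) P +
          ∑ p ∈ Finset.range P, andersonBlockMean μ E N (andersonDir E (padSeq α) (N * p) v) :=
    fun α => by
      rw [log_norm_transferProd_blocks E N (padSeq α) hv P]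
      unfold andersonBlockSum
      rw [Finset.sum_sub_distrib]
      ring
  have hS := hasSubgaussianMGF_blockSum μ hcpt hE N hv P
  have hSi : Integrable (fun α : Fin (N * P) → ℝ => andersonBlockSum μ E N v (padSeq α) P) Pm :=
    hS.integrable
  have hS0 : ∫ α, andersonBlockSum μ E N v (padSeq α) P ∂Pm = 0 :=
    integral_eq_zero_of_hasSubgaussianMGF hS
  -- the sum of block means: measurable, bounded, termwise within `N ε` of `N L`
  have hGm : Measurable fun α : Fin (N * P) → ℝ =>
      ∑ p ∈ Finset.range P, andersonBlockMean μ E N (andersonDir E (padSeq α) (N * p) v) :=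
    Finset.measurable_sum _ fun p _ =>
      measurable_andersonBlockMean_comp μ E N (continuous_andersonDir_padSeq E (N * p) hv0)
        fun α => andersonDir_ne_zero E _ _ hv0
  have hterm : ∀ (α : Fin (N * P) → ℝ) (p : ℕ),
      |andersonBlockMean μ E N (andersonDir E (padSeq α) (N * p) v) - N * L| ≤ N * ε := fun α p => by
    have h := hU _ (norm_andersonDir E (padSeq α) (N * p) hv0)
    have heq : andersonBlockMean μ E N (andersonDir E (padSeq α) (N * p) v) - N * L =
        N * (1 / (N : ℝ) * andersonBlockMean μ E N (andersonDir E (padSeq α) (N * p) v) - L) := by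
      field_simp
    rw [heq, abs_mul, abs_of_pos hNpos]
    exact mul_le_mul_of_nonneg_left h hNpos.le
  have hGb : ∀ α : Fin (N * P) → ℝ,
      |∑ p ∈ Finset.range P, andersonBlockMean μ E N (andersonDir E (padSeq α) (N * p) v) -
        P * (N * L)| ≤ P * (N * ε) := fun α => by
    have hrw : ∑ p ∈ Finset.range P, andersonBlockMean μ E N (andersonDir E (padSeq α) (N * p) v) -
        P * (N * L) =
        ∑ p ∈ Finset.range P, (andersonBlockMean μ E N (andersonDir E (padSeq α) (N * p) v) - N * L) := by
      rw [Finset.sum_sub_distrib, Finset.sum_const, Finset.card_range, nsmul_eq_mul]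
    rw [hrw]
    calc _ ≤ ∑ p ∈ Finset.range P, |andersonBlockMean μ E N (andersonDir E (padSeq α) (N * p) v) - N * L| :=
          Finset.abs_sum_le_sum_abs _ _
      _ ≤ (Finset.range P).card • (N * ε) := Finset.sum_le_card_nsmul _ _ _ fun p _ => hterm α p
      _ = P * (N * ε) := by rw [Finset.card_range, nsmul_eq_mul]
  have hGi : Integrable (fun α : Fin (N * P) → ℝ =>
      ∑ p ∈ Finset.range P, andersonBlockMean μ E N (andersonDir E (padSeq α) (N * p) v)) Pm := by
    refine Integrable.mono' (integrable_const (P * (N * ε) + |(P : ℝ) * (N * L)|)) hGm.aestronglyMeasurable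
      (ae_of_all _ fun α => ?_)
    rw [Real.norm_eq_abs]
    have := hGb α
    have h2 := abs_sub_abs_le_abs_sub
      (∑ p ∈ Finset.range P, andersonBlockMean μ E N (andersonDir E (padSeq α) (N * p) v)) (P * (N * L))
    linarith
  -- assemble
  have hmean : andersonBlockMean μ E (N * P) v =
      ∫ α, ∑ p ∈ Finset.range P, andersonBlockMean μ E N (andersonDir E (padSeq α) (N * p) v) ∂Pm := by
    calc andersonBlockMean μ E (N * P) v
        = ∫ α, Real.log ‖Matrix.toEuclideanLin (andersonTransferProd E (padSeq α) (N * P)) v‖ ∂Pm := rfl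
      _ = ∫ α, (andersonBlockSum μ E N v (padSeq α) P +
            ∑ p ∈ Finset.range P, andersonBlockMean μ E N (andersonDir E (padSeq α) (N * p) v)) ∂Pm :=
          integral_congr_ae (ae_of_all Pm hptw)
      _ = (∫ α, andersonBlockSum μ E N v (padSeq α) P ∂Pm) +
            ∫ α, ∑ p ∈ Finset.range P, andersonBlockMean μ E N (andersonDir E (padSeq α) (N * p) v) ∂Pm :=
          integral_add hSi hGi
      _ = _ := by rw [hS0, zero_add]
  have hdiff : |andersonBlockMean μ E (N * P) v - P * (N * L)| ≤ P * (N * ε) := by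
    rw [hmean, show (P : ℝ) * (N * L) = ∫ _α, (P : ℝ) * (N * L) ∂Pm by simp, ← integral_sub hGi (integrable_const _)]
    calc _ ≤ ∫ α, |∑ p ∈ Finset.range P, andersonBlockMean μ E N (andersonDir E (padSeq α) (N * p) v) -
            P * (N * L)| ∂Pm := abs_integral_le_integral_abs
      _ ≤ ∫ _α, (P : ℝ) * (N * ε) ∂Pm :=
          integral_mono_of_nonneg (ae_of_all _ fun α => abs_nonneg _) (integrable_const _)
            (ae_of_all _ fun α => hGb α)
      _ = P * (N * ε) := by simp
  have heq : 1 / ((N * P : ℕ) : ℝ) * andersonBlockMean μ E (N * P) v - L =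
      1 / ((N * P : ℕ) : ℝ) * (andersonBlockMean μ E (N * P) v - P * (N * L)) := by
    push_cast
    field_simp
  rw [heq, abs_mul, abs_of_pos (by positivity)]
  calc 1 / ((N * P : ℕ) : ℝ) * |andersonBlockMean μ E (N * P) v - P * (N * L)|
      ≤ 1 / ((N * P : ℕ) : ℝ) * (P * (N * ε)) := mul_le_mul_of_nonneg_left hdiff (by positivity)
    _ = ε := by push_cast; field_simp

/-- **Locally uniform convergence of the block means suffices**: if every `E₀ ∈ Σ̂` has a
neighbourhood and a block length on which the block means are `ε`-close to `N·L(E)` uniformly in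
the direction and in `E`, then one block length works on all of `Σ̂` (compactness of `Σ̂` and
`andersonBlockMean_mul_le` with the product of the finitely many block lengths). [folklore] -/
theorem andersonBlockMeans_uniform_of_local (μ : Measure ℝ) [IsProbabilityMeasure μ]
    (hcpt : IsCompact μ.support)
    (hloc : ∀ E₀ ∈ Set.Icc (-andersonKappa μ) (andersonKappa μ), ∀ ε : ℝ, 0 < ε →
      ∃ ρ : ℝ, 0 < ρ ∧ ∃ N : ℕ, 1 ≤ N ∧ ∀ u : EuclideanSpace ℝ (Fin 2), ‖u‖ = 1 →
        ∀ E ∈ Set.Icc (-andersonKappa μ) (andersonKappa μ), |E - E₀| < ρ →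
          |1 / (N : ℝ) * andersonBlockMean μ E N u - andersonLyapunov μ E| ≤ ε)
    {ε : ℝ} (hε : 0 < ε) :
    ∃ N : ℕ, 1 ≤ N ∧ ∀ u : EuclideanSpace ℝ (Fin 2), ‖u‖ = 1 →
      ∀ E ∈ Set.Icc (-andersonKappa μ) (andersonKappa μ),
        |1 / (N : ℝ) * andersonBlockMean μ E N u - andersonLyapunov μ E| ≤ ε := by
  classical
  set K := Set.Icc (-andersonKappa μ) (andersonKappa μ) with hK_def
  have hK : IsCompact K := isCompact_Icc
  -- choice functions, with junk values off `K`
  have hloc' : ∀ E₀ : ℝ, ∃ ρ : ℝ, 0 < ρ ∧ ∃ N : ℕ, 1 ≤ N ∧ (E₀ ∈ K →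
      ∀ u : EuclideanSpace ℝ (Fin 2), ‖u‖ = 1 → ∀ E ∈ K, |E - E₀| < ρ →
        |1 / (N : ℝ) * andersonBlockMean μ E N u - andersonLyapunov μ E| ≤ ε) := by
    intro E₀
    by_cases h0 : E₀ ∈ K
    · obtain ⟨ρ, hρ, N, hN, h⟩ := hloc E₀ h0 ε hε
      exact ⟨ρ, hρ, N, hN, fun _ => h⟩
    · exact ⟨1, one_pos, 1, le_rfl, fun h => absurd h h0⟩
  choose ρ hρ N hN hprop using hloc'
  obtain ⟨t, ht⟩ := hK.elim_finite_subcover (fun E₀ : K => Metric.ball (E₀ : ℝ) (ρ E₀))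
    (fun _ => Metric.isOpen_ball)
    fun E hE => Set.mem_iUnion.mpr ⟨⟨E, hE⟩, Metric.mem_ball_self (hρ E)⟩
  have hprod_ne : ∏ j ∈ t, N (j : ℝ) ≠ 0 :=
    Finset.prod_ne_zero_iff.mpr fun j _ => by have := hN (j : ℝ); omega
  refine ⟨∏ j ∈ t, N (j : ℝ), Nat.one_le_iff_ne_zero.mpr hprod_ne, fun u hu E hE => ?_⟩
  obtain ⟨i, hi, hEi⟩ : ∃ i ∈ t, E ∈ Metric.ball (i : ℝ) (ρ i) := by
    simpa only [Set.mem_iUnion, exists_prop] using ht hE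
  have hdist : |E - i| < ρ i := by rwa [Metric.mem_ball, Real.dist_eq] at hEi
  have hUi := hprop (i : ℝ) i.2
  obtain ⟨k, hk⟩ : N (i : ℝ) ∣ ∏ j ∈ t, N (j : ℝ) := Finset.dvd_prod_of_mem _ hi
  have hk1 : 1 ≤ k := by
    rcases Nat.eq_zero_or_pos k with rfl | hkpos
    · rw [mul_zero] at hk; exact absurd hk hprod_ne
    · exact hkpos
  have := andersonBlockMean_mul_le μ hcpt hE (hN i) (fun w hw => hUi w hw E hE hdist) hk1 hu
  rwa [← hk] at this

/-- **Prop. 3.6 from LOCALLY uniform convergence of the block means** (the form produced by a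
contradiction/compactness argument at a fixed energy). [cite: BucajEtAl2019, Prop. 3.6] -/
theorem BucajEtAl2019_vectorLDT_of_localBlockMeans
    (hloc : ∀ (μ : Measure ℝ) [IsProbabilityMeasure μ], IsCompact μ.support → μ.support.Nontrivial →
      ∀ E₀ ∈ Set.Icc (-andersonKappa μ) (andersonKappa μ), ∀ ε : ℝ, 0 < ε →
        ∃ ρ : ℝ, 0 < ρ ∧ ∃ N : ℕ, 1 ≤ N ∧ ∀ u : EuclideanSpace ℝ (Fin 2), ‖u‖ = 1 →
          ∀ E ∈ Set.Icc (-andersonKappa μ) (andersonKappa μ), |E - E₀| < ρ →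
            |1 / (N : ℝ) * andersonBlockMean μ E N u - andersonLyapunov μ E| ≤ ε) :
    BucajEtAl2019_vectorLDT := by
  intro μ _ hcpt hnt ε hε
  exact andersonVectorLDT_of_blockMeans μ hcpt
    (fun δ hδ => andersonBlockMeans_uniform_of_local μ hcpt (hloc μ hcpt hnt) hδ) hε

/-- **Thm 3.1 from LOCALLY uniform convergence of the block means**, via
`BucajEtAl2019_matrixLDT_of_vectorLDT`. [cite: BucajEtAl2019, Thm 3.1] -/
theorem BucajEtAl2019_matrixLDT_of_localBlockMeans
    (hloc : ∀ (μ : Measure ℝ) [IsProbabilityMeasure μ], IsCompact μ.support → μ.support.Nontrivial →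
      ∀ E₀ ∈ Set.Icc (-andersonKappa μ) (andersonKappa μ), ∀ ε : ℝ, 0 < ε →
        ∃ ρ : ℝ, 0 < ρ ∧ ∃ N : ℕ, 1 ≤ N ∧ ∀ u : EuclideanSpace ℝ (Fin 2), ‖u‖ = 1 →
          ∀ E ∈ Set.Icc (-andersonKappa μ) (andersonKappa μ), |E - E₀| < ρ →
            |1 / (N : ℝ) * andersonBlockMean μ E N u - andersonLyapunov μ E| ≤ ε) :
    BucajEtAl2019_matrixLDT :=
  BucajEtAl2019_matrixLDT_of_vectorLDT (BucajEtAl2019_vectorLDT_of_localBlockMeans hloc)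

end Literature.Probability.RandomMatrixProducts

end
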